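import Summits.QuantumFields.BalabanUV.T4Continuum.Support.ShellMeasureLandauEndAssembledDecayCfLinWitnessNumbers
import Summits.QuantumFields.BalabanUV.T4Continuum.Support.ShellMeasureLandauEndAssembledReachBlockP4Dim4
import Summits.QuantumFields.BalabanUV.T4Continuum.Support.ShellMeasureLandauEndAssembledDecayReachToy
import Summits.QuantumFields.BalabanUV.T4Continuum.Support.ShellMeasureSlotDimension

/-!
# `T4Continuum.ShellMeasureLiveEndOneCallUnionLevelsCfLinToyNumbers` — row S106, file 1: the NUMBERS and PER-SCALE SUPPLIES of the
# G-1 witness for THE ONE CALL OF RECORD v3 with (P4) ∧ (T1) live (file 2 `ShellMeasureLiveEndOneCallUnionLevelsCfLinToy` fires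
# S105 f3⁗ by name): the shared threshold `εθ₃ 2 d L S ½` from below, the Gibbs leg's (SM)-row at it, the core radius, finiteness
# of the live density, the one-bond chart dimension, and leaf-02's (T1) bullets made η-GENERIC (H₁ bound, R10's `hTb`, the
# `H₁ ∘ TΦ` cancellation, the smallness of the embedded read-out)
(cell `pub-balaban`, sub-cell `t4`, spine estimate NE7c (node U5b); NE7c ROUND-2 crew, unit `b2b-balaban-t4-ne7c-formalise-leaf-10` gen 13;
owner table `t4/b2b-balaban-t4-ne7c-p1/LEAVES-NE7c-P1.md` row **S106** «G-1 FOR THE ONE CALL v3 WITH (P4) ∧ (T1) LIVE» (crew-referee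
C-t4r2-374; BOOKED to this lineage R-ne7cp1-g36-8 (B), GO R-ne7cp1-g36-9∕-10 after S105 ✓ + S104 f3 ✓); ADDITIVE — imports leaf-02-g11's
S104 f3 numbers `ShellMeasureLandauEndAssembledDecayCfLinWitnessNumbers` (p237779: `tS ampT εθ₃` …), S77 f8 `…ReachBlockP4Dim4` (through it
R10 f1 `ShellMeasureLandauEndBlockSpace`: `𝕐 𝕎 C₄c c₀ rdL 𝒢L`, S77 f8 `…ReachBlockP4`: `embOf`), leaf-03's S80 f7 `…DecayReachToy`
(`b₀ readOut7 toyF7`), S101 `ShellMeasureSlotDimension` (`m₀_eq_three_mul_card`) ONLY; [folklore]; 0 `def`, 0 `def … : Prop`, 0 sorry,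
0 citation tags)

HONEST FRAMING.  Arithmetic and linear algebra on OUR toy data — nothing about Bałaban's minimiser, propagators, kernels, densities or
counts.  Finite four-torus programme, rung (B)+1 only — NOT infinite volume, NOT a mass gap, NOT the Clay problem, NOT summit progress;
NE7c (`T4IndicatorShell.ShellWeightBound` for the cell's expansions) NOT PRINTED, NOT PROVED; «NE7c ⇐ the named binders» (c3).  HONEST
DEPENDENCY (cell): continuum YM on T⁴ ⇐ BetaPertH ∧ nine spine estimates (0/9 proved); BetaPertH ⇐ (D1) ∧ (D4) ∧ CAP+tail; G-an2-4
gates asym, D1 and NE2/3/4.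

WHAT IS PROVED (kernel; [folklore] = bookkeeping).  With `t := tS d L` (leaf-02's u-tuple scale, `0 < t ≤ 1`) and `ampT 2 d L ≥ t∕16`:
* §1 **`εθ₃_half_lower`**: `εθ₃ 2 d L S ½ ≥ 10 616 832·S²` for `0 < S < t∕768` (`(R−1)² ≤ R²`, `R = t∕(768 S)`); **`gibbs_SM_shared`**:
  the Gibbs leg's (SM)-row `4(8S0)²e^{16S0} ≤ ½·(εθ₃ 2 d L S ½ · η²)` at `S0 := 16·S` for `η² ≥ ¼`, `S ≤ 10⁻³`; `two_third_le_two_sin_half`: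
  `2(S∕3) ≤ 2 sin(S∕2)` on `(0, 1]` (`Real.sin_gt_sub_cube`); `lintegral_toyF7_ne_top`∕`toyF7_measure_ne_top` (the live density is
  sub-probability); `m₀_eq_three_of_singleton` (a one-bond block has chart dimension `3`).
* §3 PACKAGED: `window_numbers`, `threshold_numbers` (the shared threshold's three facts), `one_mul_amplitude_eq`, `norm_𝒢Lη_le`.
* §4 ROWS: `alpha_rows` (R11′'s α₀-rows), `tuple_rows` (`h1 h2 hcoup`), `stokes_rows` (`hs₁ ha hma` at both scales + (SM) `hsm` WITH EQUALITY).
* §2 PER-SCALE (T1) SUPPLIES (leaf-02-g11's S104 f3 bullets with the scale `η` as a parameter): **`norm_H₁η_apply_le`**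
  (`‖((B₀η∕6)•embOf c₀ R) B‖ ≤ B₀‖B‖` for a read-out with `‖R y‖ ≤ 3‖y‖`), **`norm_TΦη_mul_lt`** (R10's number relation
  `‖(6∕(ηB₀))•id‖·(t∕768) < 2·1·1·(t(C+1)∕64)` for `η ≥ ½` — ONE polydisc radius serves both scales), **`H₁η_TΦη_apply`** (the scalars
  cancel: `H₁ (TΦ z) = embOf c₀ R z`), **`norm_embOf_readOut7_cplx_lt`** (`‖embOf c₀ readOut7 (cplx x)‖ < t∕64` on the S-ball when
  `S < tη∕384`).
NOTHING in the countdown moves; NE7c NOT PROVED; spine PROVED 0∕9.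
-/

noncomputable section

open Set Metric NormedSpace MeasureTheory Function

namespace Summit.QuantumFields.BalabanUV.T4Continuum.ShellMeasureLiveEndOneCallUnionLevelsCfLinToyNumbers

open scoped ENNReal Matrix.Norms.L2Operator
open Literature.MathematicalPhysics.QuantumFieldTheory.Balaban1983to89
open T4CubeChartGnomonic (SU2)
open ShellMeasureLandauHolonomyChart (cplx norm_cplx_le)
open ShellMeasureWilsonRealizedSU2 (M₂)
open ShellMeasureAverageProp4General (C2cov)
open ShellMeasureLandauCfPinned (C2cov_nonneg)
open ShellMeasureLandauEndAssembledDecayReachToyData (b₀ readOut7 norm_readOut7_le)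
open ShellMeasureLandauEndAssembledDecayReachToy (toyF7 toyF7_le_one)
open ShellMeasureLandauEndBlockSpace (c₀ C₄c C₄c_nonneg)
open ShellMeasureLandauEndAssembledReachBlockP4 (embOf norm_embOf_le)
open ShellMeasureLandauEndAssembledDecayCfLinWitnessNumbers (tS ampT εθ₃ tS_pos tS_le_one ampT_bounds)
open ShellMeasureSlotDimension (m₀_eq_three_mul_card)

/-! ## §1 Numbers: the shared threshold from below, the Gibbs row at `S0 = 16·S`, the core radius, finiteness, dimension -/

/-- **THE SHARED THRESHOLD FROM BELOW**: `εθ₃ 2 d L S ½ ≥ 10 616 832·S²` in the window `S < t∕768` (`t = tS d L ≤ 1`; `ampT ≥ t∕16`,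
`(R−1)² ≤ R²`, `R = t∕(768 S)`). [folklore] -/
theorem εθ₃_half_lower {d' L : ℕ} (hL : 1 ≤ L) {S : ℝ} (hS : 0 < S) (hSr : S < tS d' L / 768) :
    10616832 * S ^ 2 ≤ εθ₃ 2 d' L S (1 / 2) := by
  have ht0 := tS_pos (d' := d') hL
  have ht1 := tS_le_one (d' := d') (L := L)
  have hC := C2cov_nonneg d'
  have hC4 : 0 < C₄c 2 + 1 := by have := C₄c_nonneg 2 (by norm_num); linarith
  have hamp : tS d' L / 16 ≤ ampT 2 d' L := by
    unfold ampT
    have : 0 ≤ C2cov d' * tS d' L ^ 2 / (64 * (C₄c 2 + 1)) := by positivity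
    linarith
  have hamp0 : 0 ≤ ampT 2 d' L := by linarith
  set R : ℝ := (tS d' L * (1 / 2) / 384) / S with hR
  have hRpos : 0 < R := by rw [hR]; positivity
  have hR1 : 1 < R := by rw [hR, lt_div_iff₀ hS]; linarith
  have hRS : R * S = tS d' L / 768 := by rw [hR]; field_simp; ring
  have hnum : 18 * tS d' L ≤ 72 * (ampT 2 d' L / (1 / 2) ^ 2 * 1 + ((1 : ℕ) : ℝ) ^ 2 * (ampT 2 d' L / (1 / 2)) ^ 2 * 1 ^ 2) := by
    have : 0 ≤ (ampT 2 d' L / (1 / 2)) ^ 2 := sq_nonneg _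
    norm_num at this ⊢; nlinarith
  have hden : (R - 1) ^ 2 ≤ R ^ 2 := by nlinarith
  have hden0 : 0 < (R - 1) ^ 2 := by nlinarith
  unfold εθ₃
  rw [← hR, le_div_iff₀ hden0]
  calc 10616832 * S ^ 2 * (R - 1) ^ 2 ≤ 10616832 * S ^ 2 * R ^ 2 := by gcongr
    _ = 10616832 * (R * S) ^ 2 := by ring
    _ = 18 * tS d' L * tS d' L := by rw [hRS]; ring
    _ ≤ 18 * tS d' L * 1 := by gcongr
    _ ≤ _ := by linarith

/-- **THE GIBBS LEG's (SM)-ROW AT THE SHARED THRESHOLD**: with the Gibbs chart radius `S0 := 16·S`,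
`4(8S0)²·e^{16S0} ≤ ½·(εθ₃ 2 d L S ½ · η²)` for `η² ≥ ¼` (`S < t∕768`, `S ≤ 10⁻³`). [folklore] -/
theorem gibbs_SM_shared {d' L : ℕ} (hL : 1 ≤ L) {S : ℝ} (hS : 0 < S) (hSr : S < tS d' L / 768) (hS3 : S ≤ 1 / 1000) {η : ℝ}
    (hη : 1 / 4 ≤ η ^ 2) :
    4 * (8 * (16 * S)) ^ 2 * Real.exp (2 * (8 * (16 * S))) ≤ 1 / 2 * (εθ₃ 2 d' L S (1 / 2) * η ^ 2) := by
  have hlow := εθ₃_half_lower hL hS hSr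
  have he : Real.exp (2 * (8 * (16 * S))) ≤ Real.exp 1 := Real.exp_le_exp.2 (by linarith)
  have he1 := Real.exp_one_lt_d9
  have hθ0 : 0 ≤ εθ₃ 2 d' L S (1 / 2) := le_trans (by positivity) hlow
  calc 4 * (8 * (16 * S)) ^ 2 * Real.exp (2 * (8 * (16 * S))) ≤ 4 * (8 * (16 * S)) ^ 2 * Real.exp 1 := by gcongr
    _ ≤ 65536 * S ^ 2 * 2.7182818286 := by nlinarith [sq_nonneg S]
    _ ≤ 1 / 2 * (10616832 * S ^ 2 * (1 / 4)) := by nlinarith [sq_nonneg S]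
    _ ≤ 1 / 2 * (εθ₃ 2 d' L S (1 / 2) * η ^ 2) := by gcongr

/-- `2·(S∕3) ≤ 2 sin(S∕2)` for `0 < S ≤ 1` (`sin x > x − x³∕6`). [folklore] -/
theorem two_third_le_two_sin_half {S : ℝ} (hS : 0 < S) (hS1 : S ≤ 1) : 2 * (S / 3) ≤ 2 * Real.sin (S / 2) := by
  have h := Real.sin_gt_sub_cube (by positivity : 0 < S / 2)
  nlinarith [sq_nonneg S, mul_pos hS hS]

section Live

variable {P : Params} {j : ℕ} [DecidableEq (PBond P j)]

/-- the live density integrates to at most `1`: END-I's `hFfin`. [folklore] -/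
theorem lintegral_toyF7_ne_top (lo : Fin P.d → ℤ) {i₀ i₁ : Fin P.d} (h01 : i₀ < i₁) (a : ℝ) :
    ∫⁻ U, toyF7 lo h01 a U ∂(fieldMeasure P j SU2) ≠ ∞ :=
  ne_top_of_le_ne_top ENNReal.one_ne_top
    ((lintegral_mono fun U => toyF7_le_one lo h01 a U).trans_eq (by rw [lintegral_one, measure_univ]))

/-- the live slot's realized law is finite on every event. [folklore] -/
theorem toyF7_measure_ne_top (lo : Fin P.d → ℤ) {i₀ i₁ : Fin P.d} (h01 : i₀ < i₁) (a : ℝ) (B : Set (GaugeField P j SU2)) :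
    ((fieldMeasure P j SU2).withDensity (toyF7 lo h01 a)) B ≠ ∞ := by
  refine ne_top_of_le_ne_top ?_ (measure_mono (subset_univ B))
  rw [withDensity_apply _ MeasurableSet.univ, Measure.restrict_univ]
  exact lintegral_toyF7_ne_top lo h01 a

end Live

/-- a one-bond block has chart dimension `m₀ = 3` (S101 `m₀_eq_three_mul_card`). [folklore] -/
theorem m₀_eq_three_of_singleton {P : Params} {j : ℕ} (b : PBond P j) {m₀ : ℕ}
    (e : ↥({b} : Finset (PBond P j)) × Fin 3 ≃ Fin m₀) : m₀ = 3 := by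
  rw [m₀_eq_three_mul_card {b} e, Finset.card_singleton]

/-! ## §2 Per-scale (T1) supplies: leaf-02's S104 f3 bullets with the scale `η` as a parameter -/

section Scale

variable {X : Type*} [NormedAddCommGroup X] [NormedSpace ℂ X]

/-- **(103)-TYPE BOUND FOR THE EMBEDDED READ-OUT**: `‖((B₀∕(6∕η))•embOf c₀ R) B‖ ≤ B₀‖B‖` for a read-out with `‖R y‖ ≤ 3‖y‖`,
`B₀ = 1∕(C+1)`, `0 < η ≤ 1` (leaf-02's `hH₁` bullet). [folklore] -/
theorem norm_H₁η_apply_le (R : X →L[ℂ] M₂) (hR : ∀ y, ‖R y‖ ≤ 3 * ‖y‖) {η C : ℝ} (hη0 : 0 < η) (hη1 : η ≤ 1) (hC1 : 0 < C + 1)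
    (B : X) : ‖((((1 / (C + 1)) / (6 / η) : ℝ) : ℂ) • embOf 2 η (c₀ 2) R) B‖ ≤ 1 / (C + 1) * ‖B‖ := by
  rw [smul_apply, norm_smul, Complex.norm_real, Real.norm_of_nonneg (by positivity)]
  calc (1 / (C + 1)) / (6 / η) * ‖embOf 2 η (c₀ 2) R B‖ ≤ (1 / (C + 1)) / (6 / η) * (2 / η * (3 * ‖B‖)) :=
        mul_le_mul_of_nonneg_left (norm_embOf_le 2 hη0 hη1 (c₀ 2) R (by norm_num) hR B) (by positivity)
    _ = 1 / (C + 1) * ‖B‖ := by field_simp; ring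

/-- **R10's NUMBER RELATION AT SCALE `η ≥ ½` WITH ONE POLYDISC RADIUS**: `‖(6∕(ηB₀))•id‖·(t∕768) < 2·1·1·(t(C+1)∕64)` (`B₀ = 1∕(C+1)`;
`‖id‖ ≤ 1`, `6∕η ≤ 12`). [folklore] -/
theorem norm_TΦη_mul_lt {m : ℕ} {η t C : ℝ} (hη0 : 0 < η) (hηh : 1 / 2 ≤ η) (ht0 : 0 < t) (hC : 0 ≤ C) :
    ‖((((6 / η) / (1 / (C + 1))) : ℝ) : ℂ) • ContinuousLinearMap.id ℂ (Fin m → ℂ)‖ * (t / 768) < 2 * 1 * 1 * (t * (C + 1) / 64) := by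
  have hC1 : 0 < C + 1 := by linarith
  have hT : ‖((((6 / η) / (1 / (C + 1))) : ℝ) : ℂ) • ContinuousLinearMap.id ℂ (Fin m → ℂ)‖ ≤ (6 / η) / (1 / (C + 1)) := by
    rw [norm_smul, Complex.norm_real, Real.norm_of_nonneg (by positivity)]
    exact mul_le_of_le_one_right (by positivity) ContinuousLinearMap.norm_id_le
  have h6 : 6 / η ≤ 12 := by rw [div_le_iff₀ hη0]; linarith
  have h12 : (6 / η) / (1 / (C + 1)) ≤ 12 * (C + 1) := by
    rw [div_div_eq_mul_div, div_one]
    exact mul_le_mul_of_nonneg_right h6 hC1.le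
  calc ‖((((6 / η) / (1 / (C + 1))) : ℝ) : ℂ) • ContinuousLinearMap.id ℂ (Fin m → ℂ)‖ * (t / 768)
      ≤ 12 * (C + 1) * (t / 768) := mul_le_mul_of_nonneg_right (hT.trans h12) (by positivity)
    _ = t * (C + 1) / 64 := by ring
    _ < 2 * 1 * 1 * (t * (C + 1) / 64) := by have := mul_pos ht0 hC1; linarith

/-- **THE SCALARS CANCEL**: `((B₀∕(6∕η))•embOf c₀ R) (((6∕η)∕B₀)•id z) = embOf c₀ R z`. [folklore] -/
theorem H₁η_TΦη_apply {m : ℕ} (R : (Fin m → ℂ) →L[ℂ] M₂) {η C : ℝ} (hη : η ≠ 0) (hC1 : C + 1 ≠ 0) (z : Fin m → ℂ) :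
    ((((1 / (C + 1)) / (6 / η) : ℝ) : ℂ) • embOf 2 η (c₀ 2) R)
        ((((((6 / η) / (1 / (C + 1))) : ℝ) : ℂ) • ContinuousLinearMap.id ℂ (Fin m → ℂ)) z) = embOf 2 η (c₀ 2) R z := by
  have h1 : (1 / (C + 1)) / (6 / η) * ((6 / η) / (1 / (C + 1))) = (1 : ℝ) := by field_simp
  rw [smul_apply, smul_apply, ContinuousLinearMap.coe_id', id,
    map_smul, smul_smul, ← Complex.ofReal_mul, h1, Complex.ofReal_one, one_smul]

/-- **THE EMBEDDED READ-OUT OF A CHART POINT IS SMALL**: `‖embOf c₀ readOut7 (cplx x)‖ < t∕64` for `‖x‖ ≤ S < tη∕384`, `0 < η ≤ 1`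
(leaf-02's `h𝔄`). [folklore] -/
theorem norm_embOf_readOut7_cplx_lt {P : Params} {j : ℕ} [DecidableEq (PBond P j)] (lo : Fin P.d → ℤ) {i₀ i₁ : Fin P.d} {m₀ : ℕ}
    (e : ↥({b₀ lo i₀ i₁} : Finset (PBond P j)) × Fin 3 ≃ Fin m₀) {η t S : ℝ} (hη0 : 0 < η) (hη1 : η ≤ 1)
    (hSr : S < t * η / 384) {x : Fin m₀ → ℝ} (hxS : ‖x‖ ≤ S) : ‖embOf 2 η (c₀ 2) (readOut7 lo e) (cplx x)‖ < t / 64 :=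
  calc ‖embOf 2 η (c₀ 2) (readOut7 lo e) (cplx x)‖ ≤ 2 / η * (3 * ‖cplx x‖) :=
        norm_embOf_le 2 hη0 hη1 (c₀ 2) (readOut7 lo e) (by norm_num) (norm_readOut7_le lo e) _
    _ = 6 / η * ‖cplx x‖ := by ring
    _ ≤ 6 / η * S := mul_le_mul_of_nonneg_left ((norm_cplx_le x).trans hxS) (by positivity)
    _ < 6 / η * (t * η / 384) := mul_lt_mul_of_pos_left hSr (by positivity)
    _ = t / 64 := by field_simp; ring

end Scale


/-! ## §3 The toy's number facts, packaged (file 2 `obtain`s them) -/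

section Packaged

open ShellMeasureLandauEndBlockSpace (𝕎 𝒢L norm_𝒢L_le)
open ShellMeasureLandauEndAssembledDecayCfLinWitnessNumbers (εθ₃_pos εθ₃_eta_sq_le)

/-- the live chart radius window `0 < S ≤ t²∕10⁹`: every smallness fact file 2 uses. [folklore] -/
theorem window_numbers {d' L : ℕ} (hL : 1 ≤ L) {S : ℝ} (hS : 0 < S) (hSb : S ≤ tS d' L ^ 2 / 10 ^ 9) :
    S ≤ 1 / 10 ^ 9 ∧ S < tS d' L / 768 ∧ (∀ r : Bool, S < tS d' L * cond r 1 (1 / 2) / 384) ∧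
      S ≤ tS d' L ^ 2 * (1 / 2) ^ 2 / 10 ^ 8 ∧ 3 * S ^ 2 < Real.pi ^ 2 ∧ 3 * (16 * S) ^ 2 < Real.pi ^ 2 := by
  have ht0 := tS_pos (d' := d') hL
  have ht1 := tS_le_one (d' := d') (L := L)
  have ht2 : tS d' L ^ 2 ≤ tS d' L := by nlinarith
  have hS9 : S ≤ 1 / 10 ^ 9 := hSb.trans (div_le_div_of_nonneg_right (ht2.trans ht1) (by norm_num))
  have hSt : S ≤ tS d' L / 10 ^ 9 := hSb.trans (div_le_div_of_nonneg_right ht2 (by norm_num))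
  have hSr : S < tS d' L / 768 := lt_of_le_of_lt hSt (by linarith)
  refine ⟨hS9, hSr, fun r => by cases r <;> norm_num <;> linarith, hSb.trans ?_, by nlinarith [Real.pi_gt_three],
    by nlinarith [Real.pi_gt_three]⟩
  have h0 : 0 ≤ tS d' L ^ 2 := sq_nonneg _
  linarith

/-- the SHARED threshold `θ = εθ₃ 2 d L S ½`: positive, below the core radius `S∕3` at both scales, and the Gibbs leg's (SM)-row at
both scales (`S0 = 16 S`). [folklore] -/
theorem threshold_numbers {d' L : ℕ} (hL : 1 ≤ L) {S : ℝ} (hS : 0 < S) (hSb : S ≤ tS d' L ^ 2 / 10 ^ 9) {θ : ℝ}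
    (hθ : θ = εθ₃ 2 d' L S (1 / 2)) :
    0 < θ ∧ (∀ r : Bool, θ * cond r (1 : ℝ) (1 / 2) ^ 2 ≤ S / 3) ∧
      ∀ r : Bool, 4 * (8 * (16 * S)) ^ 2 * Real.exp (2 * (8 * (16 * S))) ≤ 1 / 2 * (θ * cond r (1 : ℝ) (1 / 2) ^ 2) := by
  obtain ⟨hS9, hSr, hSrη, hSb4, -, -⟩ := window_numbers hL hS hSb
  have hθ0 : 0 < θ := by rw [hθ]; exact εθ₃_pos (d := 2) (by norm_num) hL hS (by norm_num) (by linarith [hSrη false])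
  have hθS : θ ≤ S / 3 := by
    have h := εθ₃_eta_sq_le (d := 2) (d' := d') (L := L) (by norm_num) hL (η := 1 / 2) (by norm_num) (by norm_num) hS hSb4
    rw [hθ]; linarith
  refine ⟨hθ0, fun r => by cases r <;> norm_num <;> nlinarith, fun r => ?_⟩
  rw [hθ]; exact gibbs_SM_shared hL hS hSr (by linarith) (by cases r <;> norm_num)

/-- the (T1) read-out amplitude of the host IS leaf-02's `ampT 2 d L` at `B₀ = 1∕(C₄c 2 + 1)`, `ε₄ = t∕32`, `ε₁ = t(C₄c 2 + 1)∕64`. [folklore] -/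
theorem one_mul_amplitude_eq (d' L : ℕ) :
    (1 : ℝ) * ((tS d' L / 32 + 1 / (C₄c 2 + 1) * (2 * 1 * 1 * (tS d' L * (C₄c 2 + 1) / 64))) +
      1 / (C₄c 2 + 1) * (4 * C2cov d' * (tS d' L / 32 + 1 / (C₄c 2 + 1) * (2 * 1 * 1 * (tS d' L * (C₄c 2 + 1) / 64))) ^ 2)) =
      ampT 2 d' L := by
  have hC4 : 0 < C₄c 2 + 1 := by have := C₄c_nonneg 2 (by norm_num); linarith
  unfold ampT; field_simp; ring

/-- the propagator letter's (P2)-row at scale `η`: `‖𝒢L 2 η (B₀η∕2) f‖ ≤ B₀‖f‖`, `B₀ = 1∕(C₄c 2 + 1)`. [folklore] -/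
theorem norm_𝒢Lη_le {η : ℝ} (hη0 : 0 < η) (hη1 : η ≤ 1) (f : 𝕎 2) :
    ‖𝒢L 2 η (1 / (C₄c 2 + 1) * η / 2) f‖ ≤ 1 / (C₄c 2 + 1) * ‖f‖ := by
  have hC4 : 0 < C₄c 2 + 1 := by have := C₄c_nonneg 2 (by norm_num); linarith
  have hs0 : 0 ≤ 1 / (C₄c 2 + 1) * η / 2 := by positivity
  exact (norm_𝒢L_le 2 hη0 hη1 hs0 f).trans (le_of_eq (by have := hη0.ne'; field_simp))

end Packaged


/-! ## §4 The remaining number rows of the host at the toy's letters (file 2 passes them by name) -/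

section Rows

open B7Prop2Explicit (C0 c2' C0_pos c2'_pos)
open ShellMeasureAverageProp4General (O1cov O1cov_pos)
open ShellMeasureLandauEndAssembledDecayCfLinWitnessNumbers (α₀S)

/-- the three `α₀`-rows of R11′ at `α₀ := α₀S d L` (leaf-02's bullets `hα3 hα4 hα6`). [folklore] -/
theorem alpha_rows (d' L : ℕ) :
    C0 d' * α₀S d' L ≤ 1 / 3 ∧ 4 * α₀S d' L ≤ c2' d' L ∧ 4 * O1cov d' * α₀S d' L ≤ 1 / 3 := by
  have h0 := C0_pos d'
  have h1 := O1cov_pos d'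
  refine ⟨?_, by have : α₀S d' L ≤ c2' d' L / 4 := min_le_left _ _; linarith, ?_⟩
  · calc C0 d' * α₀S d' L ≤ C0 d' * (1 / (3 * C0 d')) :=
          mul_le_mul_of_nonneg_left ((min_le_right _ _).trans (min_le_left _ _)) h0.le
      _ = 1 / 3 := by field_simp
  · calc 4 * O1cov d' * α₀S d' L ≤ 4 * O1cov d' * (1 / (12 * O1cov d')) :=
          mul_le_mul_of_nonneg_left ((min_le_right _ _).trans (min_le_right _ _)) (by positivity)
      _ = 1 / 3 := by field_simp; ring

/-- the u-tuple's rows `h1`, `h2`, `hcoup` at `B₀ = 1∕(C+1)`, `ε₄ = t∕32`, `ε₁ = t(C+1)∕64`, `a₃ = 1∕8`, `ε₃ = t∕16` (`0 ≤ C`, `t ≤ 1`).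
[folklore] -/
theorem tuple_rows {C t : ℝ} (hC : 0 ≤ C) (ht1 : t ≤ 1) :
    2 * (1 / (C + 1)) * 1 * 1 * (t * (C + 1) / 64) ≤ t / 32 ∧ 4 * (t / 32) ≤ 1 / 8 ∧
      t / 32 + 1 / (C + 1) * (2 * 1 * 1 * (t * (C + 1) / 64)) ≤ t / 16 := by
  have hC1 : C + 1 ≠ 0 := (by linarith : 0 < C + 1).ne'
  refine ⟨le_of_eq (by field_simp; ring), by linarith, le_of_eq (by field_simp; ring)⟩

/-- the Stokes-currency rows `hs₁ ha hma` at BOTH scales with the run-uniform letters `c₁ = 4·ampT`, `c₂ = 2·ampT`, `zs = 1`, `κ_r = κ_c = 1`,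
`m = 1`, and (SM) `hsm` WITH EQUALITY at the shared threshold `εθ₃ 2 d L S ½` and the single polydisc radius `t∕768`. [folklore] -/
theorem stokes_rows (d' L : ℕ) (hL : 1 ≤ L) (S : ℝ) (r : Bool) :
    (1 * ((tS d' L / 32 + 1 / (C₄c 2 + 1) * (2 * 1 * 1 * (tS d' L * (C₄c 2 + 1) / 64))) +
        1 / (C₄c 2 + 1) * (4 * C2cov d' * (tS d' L / 32 + 1 / (C₄c 2 + 1) * (2 * 1 * 1 * (tS d' L * (C₄c 2 + 1) / 64))) ^ 2)) ≤
        4 * ampT 2 d' L * cond r (1 : ℝ) (1 / 2) ^ 2 * 1) ∧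
    (1 * ((tS d' L / 32 + 1 / (C₄c 2 + 1) * (2 * 1 * 1 * (tS d' L * (C₄c 2 + 1) / 64))) +
        1 / (C₄c 2 + 1) * (4 * C2cov d' * (tS d' L / 32 + 1 / (C₄c 2 + 1) * (2 * 1 * 1 * (tS d' L * (C₄c 2 + 1) / 64))) ^ 2)) ≤
        2 * ampT 2 d' L * cond r (1 : ℝ) (1 / 2) * 1) ∧
    (((1 : ℕ) : ℝ) * (1 * ((tS d' L / 32 + 1 / (C₄c 2 + 1) * (2 * 1 * 1 * (tS d' L * (C₄c 2 + 1) / 64))) +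
        1 / (C₄c 2 + 1) * (4 * C2cov d' * (tS d' L / 32 + 1 / (C₄c 2 + 1) * (2 * 1 * 1 * (tS d' L * (C₄c 2 + 1) / 64))) ^ 2))) ≤ 1) ∧
    36 * (4 * ampT 2 d' L * 1 + ((1 : ℕ) : ℝ) ^ 2 * (2 * ampT 2 d' L) ^ 2 * 1 ^ 2) / ((tS d' L / 768) / S - 1) ^ 2 ≤
      1 / 2 * εθ₃ 2 d' L S (1 / 2) := by
  have hamp := one_mul_amplitude_eq d' L
  obtain ⟨hA0, hA1⟩ := ampT_bounds (d := 2) (d' := d') (L := L) (by norm_num) hL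
  have hηq : 1 / 4 ≤ cond r (1 : ℝ) (1 / 2) ^ 2 := by cases r <;> norm_num
  have hηh : 1 / 2 ≤ cond r (1 : ℝ) (1 / 2) := by cases r <;> norm_num
  refine ⟨by rw [hamp]; nlinarith, by rw [hamp]; nlinarith, by rw [hamp, Nat.cast_one, one_mul]; linarith, le_of_eq ?_⟩
  unfold εθ₃
  rw [show tS d' L * (1 / 2) / 384 = tS d' L / 768 by ring]
  ring

end Rows

end Summit.QuantumFields.BalabanUV.T4Continuum.ShellMeasureLiveEndOneCallUnionLevelsCfLinToyNumbers

end
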